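import Summits.QuantumFields.BalabanUV.T4Continuum.Support.NE3RightInverseLetters
import HarnessLib

/-!
# T⁴ programme, node NE3 — REPAIR R24 (γ1): THE CURL LETTERS (R2), (R3), (R6′) OF ROUTE Π's COVARIANT LIFT ALONE (no frame corrector) —
# `curlSq`, `Σ‖curl‖` and the window sup-curl of `covLift M W Φ`, and of the QbarIter-right-inverse `covLift M W (ext((1+K)⁻¹ res φ))`, k-FREE

Cell `pub-balaban-gaps` (YM blitz, track G2, seat `ne3`, unit `pub-balaban-gaps-ne3`; writer prover-pub-balaban-gaps-ne3-g3-0, 2026-08-23), census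
`run/shared/lean/pub/pub-balaban-gaps/ne/NE3.md` §4 R24 (γ1).  The lineage's `NE3HatInvCurlLetters` sums the pointwise covariant curl of the lift
(`NE3CovLiftCurl.norm_curl_covLift_le`: `‖curl_W (covLift M W Φ)(x; μ,ν)‖ ≤ liftC·(1∕M² + 16(d+1)x_W)·(‖Φ(blk x,μ)‖ + ‖Φ(blk x,ν)‖)`) for the CORRECTED field
`hatInvW = covLift + gaugeDir W ζ` (its `hlift` steps are internal to the proofs of `curlSq_hatInvW_le` ∕ `sum_norm_curl_hatInvW_le`).  On B8's surface the right inverse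
of `QbarIter` is the lift ALONE (`Spine/NE3/QbarRightInverseB8.QbarIter_covLift_solveW`), so THIS FILE re-exports the lift's part of those sums as stand-alone letters
(constants `4d·liftC²(17+16d)²` and `2d·liftC(17+16d)` in the regime `M²x_W ≤ 1` — the `frameC`∕`frameRad` terms of `curl2C`∕`curl1C` are absent) and composes them
with the solve letters (`NE3RightInverseSolveLetters.dirSq_solve_le` ∕ `dirL1_solve_le` ∕ `norm_solve_le`) in the junction's currency.

CONTENT ([folklore]; 0 sorry; no `def`): §1 `liftCurlC_le` (the regime bound `liftC(1∕M² + 16(d+1)x) ≤ liftC(17+16d)∕M²`), **`curlSq_covLift_le`**, **`sum_norm_curl_covLift_le`**,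
**`norm_curl_covLift_le_of_sup`**; §2 the same for the lift of the solved datum: **`covLift_solveW_R2`**, **`covLift_solveW_R3`**, **`covLift_solveW_R6`** (on `perWin`).

HONEST FRAMING.  Kinematics of OUR objects; constants explicit and crude; nothing about minimisers; the chart supplier, (P♮), (RES♯), the covariant root and **NE3 are
NOT proved**; spine PROVED 0∕9; finite T⁴ rung (B)+1 — NOT infinite volume, NOT mass gap, NOT `BetaPertH`, NOT Clay.  PLACEMENT:
`Summits/QuantumFields/BalabanUV/T4Continuum/Spine/NE3/`; imports accepted modules only; moves nothing.  HONEST DEPENDENCY (cell page 1): continuum YM on T⁴ ⇐ BetaPertH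
∧ nine spine estimates (0/9 proved); BetaPertH ⇐ (D1) ∧ (D4) ∧ CAP+tail; G-an2-4 gates asym, D1 and NE2/3/4.
-/

set_option autoImplicit false

open scoped BigOperators Matrix.Norms.L2Operator
open Finset

namespace Summit.QuantumFields.BalabanUV.T4Continuum.NE3.CovLiftCurlLettersB8

open Literature.MathematicalPhysics.QuantumFieldTheory.Balaban1983to89
open B7Prop1Explicit B7Prop2Explicit
open T4AveragingDeficitWall (IsUnitaryCfg IsSkewDir SmallField curl curlSq dirSq dirL1)
open T4AveragingDeficitWallBoundary (IsPeriodicCfg periodBox card_periodBox)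
open AveragingDeficitPeriodicCounting (IsPeriodicDir)
open AveragingDeficitMultiLevelPrep (LevelSmall tower)
open AveragingDeficitTwoLevelPrep (skewSub)
open AveragingDeficitTorusChart (TDir extDir resDir isPeriodicDir_extDir)
open SmoothRefineBlocks (blk)
open NE3CoarseInterpolant (blk_block)
open NE3BlockLineAverage (sum_periodBox_blocks)
open NE3SpreadLiftCurl (sum_plane_pair_le)
open MinimalActionLevels (perWin)
open NE3CovariantLift (covLift)
open NE3QbarIterCovLiftPrep (cruxC liftC liftC_nonneg)
open NE3CovLiftCurl (norm_curl_covLift_le)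
open NE3SmoothRightInverseW (solveW resSkew)
open NE3RightInverseSolveLetters (thetaLoc dirSq_solve_le dirL1_solve_le norm_solve_le)

noncomputable section

variable {d : ℕ} {n : Type*} [Fintype n] [DecidableEq n]

/-! ## §1 The curl letters of the lift alone -/

/-- In the regime `M²·x ≤ 1`: `liftC·(1∕M² + 16(d+1)x) ≤ liftC·(17+16d)∕M²`. [folklore] -/
theorem liftCurlC_le {M : ℕ} (hM : 1 ≤ M) {x : ℝ} (hx : 0 ≤ x) (hε : (M : ℝ) ^ 2 * x ≤ 1) :
    liftC d * (1 / (M : ℝ) ^ 2 + 16 * ((d : ℝ) + 1) * x) ≤ liftC d * (17 + 16 * (d : ℝ)) / (M : ℝ) ^ 2 := by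
  have hM0 : (0 : ℝ) < (M : ℝ) := by exact_mod_cast (show 0 < M by omega)
  have hMsq : (0 : ℝ) < (M : ℝ) ^ 2 := by positivity
  have hl0 := liftC_nonneg d
  rw [le_div_iff₀ hMsq]
  have : liftC d * (1 / (M : ℝ) ^ 2 + 16 * ((d : ℝ) + 1) * x) * (M : ℝ) ^ 2 = liftC d * (1 + 16 * ((d : ℝ) + 1) * ((M : ℝ) ^ 2 * x)) := by
    field_simp
  rw [this]
  have h16 : 0 ≤ 16 * ((d : ℝ) + 1) := by positivity
  nlinarith [mul_le_mul_of_nonneg_left hε h16, mul_nonneg hl0 (mul_nonneg h16 (sub_nonneg.2 hε))]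

/-- **(R2) FOR THE LIFT ALONE** (`M ≥ 2`, unitary `W` with `SmallField W x`, regime `M²x ≤ 1`, any `N`):
`curlSq W (covLift M W Φ) (periodBox (M·N)) ≤ 4d·(liftC(17+16d))²·(M^d ∕ M⁴)·dirSq Φ (periodBox N)`. [folklore] -/
theorem curlSq_covLift_le [Nonempty n] {M : ℕ} (hM : 2 ≤ M) (N : ℕ) {W : Site d → Fin d → (Matrix n n ℂ)ˣ} {x : ℝ}
    (hWu : IsUnitaryCfg W) (hx : 0 ≤ x) (hWx : SmallField W x) (hε : (M : ℝ) ^ 2 * x ≤ 1) (Φ : Site d → Fin d → Matrix n n ℂ) :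
    curlSq W (covLift M W Φ) (periodBox (d := d) (M * N))
      ≤ 4 * d * (liftC d * (17 + 16 * (d : ℝ))) ^ 2 * ((M : ℝ) ^ d / (M : ℝ) ^ 4) * dirSq Φ (periodBox (d := d) N) := by
  have hM1 : 1 ≤ M := by omega
  have hM0 : (0 : ℝ) < (M : ℝ) := by exact_mod_cast (show 0 < M by omega)
  set C : ℝ := liftC d * (1 / (M : ℝ) ^ 2 + 16 * ((d : ℝ) + 1) * x) with hC
  have hC0 : 0 ≤ C := by have := liftC_nonneg d; positivity
  have hCle : C ≤ liftC d * (17 + 16 * (d : ℝ)) / (M : ℝ) ^ 2 := liftCurlC_le hM1 hx hε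
  set D : ℝ := dirSq Φ (periodBox (d := d) N) with hD
  have hD0 : 0 ≤ D := by rw [hD]; unfold dirSq; positivity
  have hsite : ∀ y : Site d, ∑ π : T4AveragingDeficitWall.Plane d, ‖curl W (covLift M W Φ) (y, π)‖ ^ 2
      ≤ 2 * C ^ 2 * (2 * d * ∑ κ : Fin d, ‖Φ (blk M y) κ‖ ^ 2) := by
    intro y
    have hpl : ∀ π : T4AveragingDeficitWall.Plane d, ‖curl W (covLift M W Φ) (y, π)‖ ^ 2
        ≤ 2 * C ^ 2 * (‖Φ (blk M y) π.1.1‖ ^ 2 + ‖Φ (blk M y) π.1.2‖ ^ 2) := by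
      intro π
      have h := norm_curl_covLift_le hM hWu hx hWx Φ (y, π)
      rw [← hC] at h
      calc ‖curl W (covLift M W Φ) (y, π)‖ ^ 2 ≤ (C * (‖Φ (blk M y) π.1.1‖ + ‖Φ (blk M y) π.1.2‖)) ^ 2 :=
            pow_le_pow_left₀ (norm_nonneg _) h 2
        _ ≤ _ := by rw [mul_pow]; nlinarith [sq_nonneg (‖Φ (blk M y) π.1.1‖ - ‖Φ (blk M y) π.1.2‖), sq_nonneg C]
    calc _ ≤ ∑ π : T4AveragingDeficitWall.Plane d, 2 * C ^ 2 * (‖Φ (blk M y) π.1.1‖ ^ 2 + ‖Φ (blk M y) π.1.2‖ ^ 2) :=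
          Finset.sum_le_sum fun π _ => hpl π
      _ = 2 * C ^ 2 * ∑ π : T4AveragingDeficitWall.Plane d, (‖Φ (blk M y) π.1.1‖ ^ 2 + ‖Φ (blk M y) π.1.2‖ ^ 2) := by rw [Finset.mul_sum]
      _ ≤ _ := mul_le_mul_of_nonneg_left (sum_plane_pair_le (h := fun κ => ‖Φ (blk M y) κ‖ ^ 2) fun κ => sq_nonneg _) (by positivity)
  have hlift : curlSq W (covLift M W Φ) (periodBox (d := d) (M * N)) ≤ 4 * d * C ^ 2 * (M : ℝ) ^ d * D := by
    unfold curlSq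
    calc ∑ y ∈ periodBox (d := d) (M * N), ∑ π : T4AveragingDeficitWall.Plane d, ‖curl W (covLift M W Φ) (y, π)‖ ^ 2
        ≤ ∑ y ∈ periodBox (d := d) (M * N), 2 * C ^ 2 * (2 * d * ∑ κ : Fin d, ‖Φ (blk M y) κ‖ ^ 2) := Finset.sum_le_sum fun y _ => hsite y
      _ = (M : ℝ) ^ d * ∑ z ∈ periodBox (d := d) N, 2 * C ^ 2 * (2 * d * ∑ κ : Fin d, ‖Φ z κ‖ ^ 2) := by
          rw [← sum_periodBox_blocks M N hM1, Finset.mul_sum]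
          refine Finset.sum_congr rfl fun z _ => ?_
          rw [Finset.sum_congr rfl fun v hv => by rw [blk_block hM1 z hv], Finset.sum_const, card_periodBox, nsmul_eq_mul, Nat.cast_pow]
      _ = 4 * d * C ^ 2 * (M : ℝ) ^ d * D := by rw [hD]; unfold dirSq; simp only [← Finset.mul_sum]; ring
  -- `C² ≤ (liftC(17+16d))²/M⁴`
  have hC2 : C ^ 2 ≤ (liftC d * (17 + 16 * (d : ℝ))) ^ 2 / (M : ℝ) ^ 4 := by
    have h := pow_le_pow_left₀ hC0 hCle 2
    rw [div_pow] at h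
    have : ((M : ℝ) ^ 2) ^ 2 = (M : ℝ) ^ 4 := by ring
    rwa [this] at h
  have hrest : 0 ≤ 4 * (d : ℝ) * ((M : ℝ) ^ d * D) := by positivity
  calc curlSq W (covLift M W Φ) (periodBox (d := d) (M * N)) ≤ 4 * d * C ^ 2 * (M : ℝ) ^ d * D := hlift
    _ = C ^ 2 * (4 * (d : ℝ) * ((M : ℝ) ^ d * D)) := by ring
    _ ≤ (liftC d * (17 + 16 * (d : ℝ))) ^ 2 / (M : ℝ) ^ 4 * (4 * (d : ℝ) * ((M : ℝ) ^ d * D)) := mul_le_mul_of_nonneg_right hC2 hrest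
    _ = 4 * d * (liftC d * (17 + 16 * (d : ℝ))) ^ 2 * ((M : ℝ) ^ d / (M : ℝ) ^ 4) * D := by field_simp

/-- **(R3) FOR THE LIFT ALONE**: `Σ_{p ∈ perWin d (M·N)} ‖curl W (covLift M W Φ) p‖ ≤ 2d·liftC(17+16d)·(M^d ∕ M²)·dirL1 Φ (periodBox N)`. [folklore] -/
theorem sum_norm_curl_covLift_le [Nonempty n] {M : ℕ} (hM : 2 ≤ M) (N : ℕ) {W : Site d → Fin d → (Matrix n n ℂ)ˣ} {x : ℝ}
    (hWu : IsUnitaryCfg W) (hx : 0 ≤ x) (hWx : SmallField W x) (hε : (M : ℝ) ^ 2 * x ≤ 1) (Φ : Site d → Fin d → Matrix n n ℂ) :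
    ∑ p ∈ perWin d (M * N), ‖curl W (covLift M W Φ) p‖
      ≤ 2 * d * (liftC d * (17 + 16 * (d : ℝ))) * ((M : ℝ) ^ d / (M : ℝ) ^ 2) * dirL1 Φ (periodBox (d := d) N) := by
  have hM1 : 1 ≤ M := by omega
  have hM0 : (0 : ℝ) < (M : ℝ) := by exact_mod_cast (show 0 < M by omega)
  set C : ℝ := liftC d * (1 / (M : ℝ) ^ 2 + 16 * ((d : ℝ) + 1) * x) with hC
  have hC0 : 0 ≤ C := by have := liftC_nonneg d; positivity
  have hCle : C ≤ liftC d * (17 + 16 * (d : ℝ)) / (M : ℝ) ^ 2 := liftCurlC_le hM1 hx hε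
  set D : ℝ := dirL1 Φ (periodBox (d := d) N) with hD
  have hD0 : 0 ≤ D := by rw [hD]; unfold dirL1; positivity
  unfold perWin
  rw [Finset.sum_product]
  have hsite : ∀ y : Site d, ∑ π : T4AveragingDeficitWall.Plane d, ‖curl W (covLift M W Φ) (y, π)‖ ≤ C * (2 * d * ∑ κ : Fin d, ‖Φ (blk M y) κ‖) := by
    intro y
    have hpt : ∀ π : T4AveragingDeficitWall.Plane d, ‖curl W (covLift M W Φ) (y, π)‖ ≤ C * (‖Φ (blk M y) π.1.1‖ + ‖Φ (blk M y) π.1.2‖) := by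
      intro π; have h := norm_curl_covLift_le hM hWu hx hWx Φ (y, π); rw [← hC] at h; exact h
    refine (Finset.sum_le_sum fun π _ => hpt π).trans ?_
    rw [← Finset.mul_sum]
    exact mul_le_mul_of_nonneg_left (sum_plane_pair_le (h := fun κ => ‖Φ (blk M y) κ‖) fun κ => norm_nonneg _) hC0
  have hsum : ∑ y ∈ periodBox (d := d) (M * N), ∑ π : T4AveragingDeficitWall.Plane d, ‖curl W (covLift M W Φ) (y, π)‖ ≤ 2 * d * C * (M : ℝ) ^ d * D := by
    calc ∑ y ∈ periodBox (d := d) (M * N), ∑ π : T4AveragingDeficitWall.Plane d, ‖curl W (covLift M W Φ) (y, π)‖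
        ≤ ∑ y ∈ periodBox (d := d) (M * N), C * (2 * d * ∑ κ : Fin d, ‖Φ (blk M y) κ‖) := Finset.sum_le_sum fun y _ => hsite y
      _ = (M : ℝ) ^ d * ∑ z ∈ periodBox (d := d) N, C * (2 * d * ∑ κ : Fin d, ‖Φ z κ‖) := by
          rw [← sum_periodBox_blocks M N hM1, Finset.mul_sum]
          refine Finset.sum_congr rfl fun z _ => ?_
          rw [Finset.sum_congr rfl fun v hv => by rw [blk_block hM1 z hv], Finset.sum_const, card_periodBox, nsmul_eq_mul, Nat.cast_pow]
      _ = 2 * d * C * (M : ℝ) ^ d * D := by rw [hD]; unfold dirL1; simp only [← Finset.mul_sum]; ring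
  have hrest : 0 ≤ 2 * (d : ℝ) * ((M : ℝ) ^ d * D) := by positivity
  calc ∑ y ∈ periodBox (d := d) (M * N), ∑ π : T4AveragingDeficitWall.Plane d, ‖curl W (covLift M W Φ) (y, π)‖ ≤ 2 * d * C * (M : ℝ) ^ d * D := hsum
    _ = C * (2 * (d : ℝ) * ((M : ℝ) ^ d * D)) := by ring
    _ ≤ liftC d * (17 + 16 * (d : ℝ)) / (M : ℝ) ^ 2 * (2 * (d : ℝ) * ((M : ℝ) ^ d * D)) := mul_le_mul_of_nonneg_right hCle hrest
    _ = 2 * d * (liftC d * (17 + 16 * (d : ℝ))) * ((M : ℝ) ^ d / (M : ℝ) ^ 2) * D := by field_simp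

/-- **(R6′) FOR THE LIFT ALONE**: for `‖Φ‖_∞ ≤ S`, `‖curl W (covLift M W Φ) p‖ ≤ 2·liftC(17+16d)∕M²·S` on every plaquette (regime `M²x ≤ 1`). [folklore] -/
theorem norm_curl_covLift_le_of_sup [Nonempty n] {M : ℕ} (hM : 2 ≤ M) {W : Site d → Fin d → (Matrix n n ℂ)ˣ} {x : ℝ}
    (hWu : IsUnitaryCfg W) (hx : 0 ≤ x) (hWx : SmallField W x) (hε : (M : ℝ) ^ 2 * x ≤ 1) (Φ : Site d → Fin d → Matrix n n ℂ)
    {S : ℝ} (hS0 : 0 ≤ S) (hΦ : ∀ (z : Site d) (κ : Fin d), ‖Φ z κ‖ ≤ S) (p : T4AveragingDeficitWall.Plaq d) :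
    ‖curl W (covLift M W Φ) p‖ ≤ 2 * (liftC d * (17 + 16 * (d : ℝ))) / (M : ℝ) ^ 2 * S := by
  have hM1 : 1 ≤ M := by omega
  have h := norm_curl_covLift_le hM hWu hx hWx Φ p
  have hCle := liftCurlC_le (d := d) hM1 hx hε
  have hC0 : 0 ≤ liftC d * (1 / (M : ℝ) ^ 2 + 16 * ((d : ℝ) + 1) * x) := by have := liftC_nonneg d; positivity
  have h2 : ‖Φ (blk M p.1) p.2.1.1‖ + ‖Φ (blk M p.1) p.2.1.2‖ ≤ 2 * S := by linarith [hΦ (blk M p.1) p.2.1.1, hΦ (blk M p.1) p.2.1.2]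
  calc ‖curl W (covLift M W Φ) p‖ ≤ liftC d * (1 / (M : ℝ) ^ 2 + 16 * ((d : ℝ) + 1) * x) * (2 * S) := h.trans (mul_le_mul_of_nonneg_left h2 hC0)
    _ ≤ liftC d * (17 + 16 * (d : ℝ)) / (M : ℝ) ^ 2 * (2 * S) := mul_le_mul_of_nonneg_right hCle (by positivity)
    _ = 2 * (liftC d * (17 + 16 * (d : ℝ))) / (M : ℝ) ^ 2 * S := by ring

/-! ## §2 The curl letters of the lift of the solved datum (the `QbarIter` right inverse of `Spine/NE3/QbarRightInverseB8`) -/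

section RightInv

variable [Nonempty n] {L : ℕ} (hL : 2 ≤ L) (k : ℕ) {N : ℕ} [NeZero N] {W : Site d → Fin d → (Matrix n n ℂ)ˣ} {x : ℝ}
  (hWu : IsUnitaryCfg W) (hx : 0 ≤ x) (hs : LevelSmall d L k x) (hWx : SmallField W x)
  (hθ : cruxC d L * (((L : ℝ) ^ (k + 1)) ^ 2 * x) < 1) (hθl : thetaLoc d L * (((L : ℝ) ^ (k + 1)) ^ 2 * x) < 1)
  (hε : ((L : ℝ) ^ (k + 1)) ^ 2 * x ≤ 1) {φ : Site d → Fin d → Matrix n n ℂ} (hφ : IsSkewDir φ)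

include hθl hε in
/-- **(R2)** for the lift of the solved datum: `curlSq ≤ (4d(liftC(17+16d))² ∕ (1 − θ_loc)²)·(M^d∕M⁴)·dirSq φ (periodBox N)`. [folklore] -/
theorem covLift_solveW_R2 :
    curlSq W (covLift (L ^ (k + 1)) W (extDir N ((solveW hL k hWu hx hs hWx N hθ (resSkew N hφ) : ↥(skewSub d n N)) : TDir d n N)))
        (periodBox (d := d) (N * L ^ (k + 1)))
      ≤ (4 * d * (liftC d * (17 + 16 * (d : ℝ))) ^ 2 / (1 - thetaLoc d L * (((L : ℝ) ^ (k + 1)) ^ 2 * x)) ^ 2)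
          * (((L : ℝ) ^ (k + 1)) ^ d / ((L : ℝ) ^ (k + 1)) ^ 4) * dirSq φ (periodBox (d := d) N) := by
  have hM2 : 2 ≤ L ^ (k + 1) := hL.trans (Nat.le_self_pow (by omega) L)
  have hMr : ((L ^ (k + 1) : ℕ) : ℝ) = (L : ℝ) ^ (k + 1) := by push_cast; ring
  have hpos : 0 < 1 - thetaLoc d L * (((L : ℝ) ^ (k + 1)) ^ 2 * x) := by linarith
  have hεM : (((L ^ (k + 1) : ℕ)) : ℝ) ^ 2 * x ≤ 1 := by rw [hMr]; exact hε
  have h1 := curlSq_covLift_le hM2 N hWu hx hWx hεM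
    (extDir N ((solveW hL k hWu hx hs hWx N hθ (resSkew N hφ) : ↥(skewSub d n N)) : TDir d n N))
  have h2 := dirSq_solve_le hL k hWu hx hs hWx N hθ hθl hφ
  rw [Nat.mul_comm] at h1
  rw [hMr] at h1
  have hc : 0 ≤ 4 * d * (liftC d * (17 + 16 * (d : ℝ))) ^ 2 * (((L : ℝ) ^ (k + 1)) ^ d / ((L : ℝ) ^ (k + 1)) ^ 4) := by
    have := liftC_nonneg d; positivity
  refine h1.trans ((mul_le_mul_of_nonneg_left h2 hc).trans (le_of_eq ?_))
  field_simp

include hθl hε in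
/-- **(R3)** for the lift of the solved datum: `Σ_{perWin} ‖curl‖ ≤ (2d·liftC(17+16d) ∕ (1 − θ_loc))·(M^d∕M²)·dirL1 φ (periodBox N)`. [folklore] -/
theorem covLift_solveW_R3 :
    ∑ p ∈ perWin d (N * L ^ (k + 1)), ‖curl W (covLift (L ^ (k + 1)) W
        (extDir N ((solveW hL k hWu hx hs hWx N hθ (resSkew N hφ) : ↥(skewSub d n N)) : TDir d n N))) p‖
      ≤ (2 * d * (liftC d * (17 + 16 * (d : ℝ))) / (1 - thetaLoc d L * (((L : ℝ) ^ (k + 1)) ^ 2 * x)))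
          * (((L : ℝ) ^ (k + 1)) ^ d / ((L : ℝ) ^ (k + 1)) ^ 2) * dirL1 φ (periodBox (d := d) N) := by
  have hM2 : 2 ≤ L ^ (k + 1) := hL.trans (Nat.le_self_pow (by omega) L)
  have hMr : ((L ^ (k + 1) : ℕ) : ℝ) = (L : ℝ) ^ (k + 1) := by push_cast; ring
  have hpos : 0 < 1 - thetaLoc d L * (((L : ℝ) ^ (k + 1)) ^ 2 * x) := by linarith
  have hεM : (((L ^ (k + 1) : ℕ)) : ℝ) ^ 2 * x ≤ 1 := by rw [hMr]; exact hε
  have h1 := sum_norm_curl_covLift_le hM2 N hWu hx hWx hεM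
    (extDir N ((solveW hL k hWu hx hs hWx N hθ (resSkew N hφ) : ↥(skewSub d n N)) : TDir d n N))
  have h2 := dirL1_solve_le hL k hWu hx hs hWx N hθ hθl hφ
  rw [Nat.mul_comm] at h1
  rw [hMr] at h1
  have hc : 0 ≤ 2 * d * (liftC d * (17 + 16 * (d : ℝ))) * (((L : ℝ) ^ (k + 1)) ^ d / ((L : ℝ) ^ (k + 1)) ^ 2) := by
    have := liftC_nonneg d; positivity
  refine h1.trans ((mul_le_mul_of_nonneg_left h2 hc).trans (le_of_eq ?_))
  field_simp

include hε in
/-- **(R6′)** for the lift of the solved datum on the period window (the junction's `haN` shape): for `‖φ‖_∞ ≤ s`,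
`‖curl W (covLift M W Φ) p‖ ≤ 2·liftC(17+16d) ∕ (M²(1 − θ)) · s`. [folklore] -/
theorem covLift_solveW_R6 {s : ℝ} (hs0 : 0 ≤ s) (hφs : ∀ (z : Site d) (κ : Fin d), ‖φ z κ‖ ≤ s) :
    ∀ p ∈ perWin d (N * L ^ (k + 1)), ‖curl W (covLift (L ^ (k + 1)) W
        (extDir N ((solveW hL k hWu hx hs hWx N hθ (resSkew N hφ) : ↥(skewSub d n N)) : TDir d n N))) p‖
      ≤ 2 * (liftC d * (17 + 16 * (d : ℝ))) / (((L : ℝ) ^ (k + 1)) ^ 2 * (1 - cruxC d L * (((L : ℝ) ^ (k + 1)) ^ 2 * x))) * s := by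
  intro p _
  have hM2 : 2 ≤ L ^ (k + 1) := hL.trans (Nat.le_self_pow (by omega) L)
  have hMr : ((L ^ (k + 1) : ℕ) : ℝ) = (L : ℝ) ^ (k + 1) := by push_cast; ring
  have hpos : 0 < 1 - cruxC d L * (((L : ℝ) ^ (k + 1)) ^ 2 * x) := by linarith
  have hεM : (((L ^ (k + 1) : ℕ)) : ℝ) ^ 2 * x ≤ 1 := by rw [hMr]; exact hε
  have hS0 : 0 ≤ s / (1 - cruxC d L * (((L : ℝ) ^ (k + 1)) ^ 2 * x)) := by positivity
  have h := norm_curl_covLift_le_of_sup hM2 hWu hx hWx hεM _ hS0 (norm_solve_le hL k hWu hx hs hWx N hθ hφ hs0 hφs) p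
  rw [hMr] at h
  refine h.trans (le_of_eq ?_)
  field_simp

end RightInv

end

end Summit.QuantumFields.BalabanUV.T4Continuum.NE3.CovLiftCurlLettersB8
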